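import Literature.NumberTheory.LFunctions.CertifiedLFunctionCriticalLineBound
import Literature.NumberTheory.LFunctions.CertifiedLFunctionGammaFactorBound
import HarnessLib

/-!
# Platt's truncation bound for rigorous up-sampling of `Λ_χ`
# (Math. Comp. 85 (2016) §8, Lemmas 8.6 and 8.7) — PROVED in the form the printed proof yields

Topic `Literature/NumberTheory/LFunctions`; namespace `Literature.NumberTheory.LFunctions`, engine
sub-namespace `UpsamplingTruncation`. Everything in this file is PROVED (standard axioms; no named
fact, no definition). Typed for the parity-realchar cell (D-0088 (4) literature-typing layer, row
«Platt 2016 (Math. Comp., certified GRH/`L`-function computations)»): instrument provenance for the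
zero-LOCATING half (rigorous up-sampling, §8) of Platt's GRH verification
`Literature.NumberTheory.LFunctions.platt2016_theorem71/72` (`DirichletLRiemannHypothesisUpTo.lean`).
Companions: `CertifiedLFunctionUpsampling.lean` (Theorems 8.1–8.2, Whittaker–Shannon and Weiss),
`CertifiedLFunctionGammaFactorBound.lean` (Lemma 8.3), `CertifiedLFunctionGaussianWindow.lean`
(Lemma 8.4), `CertifiedLFunctionWindowAliasingBound.lean` (Lemma 8.5),
`CertifiedLFunctionCriticalLineBound.lean` (Lemma 7.3). With this file every numbered statement of
Platt's §§3–8 is a theorem of the tree (as printed, or — 7.6, 8.6, 8.7 — as its printed proof yields).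

## Source (journal pdf `paper:url-20e4f76cdba6` p. 3023, read this session; = arXiv:1305.3087v1
## Lemmas 6.6–6.7 pp. 13–14 = Platt's 2011 Bristol thesis Lemmas 7.3.4–7.3.5, PDF p. 98 — the three
## printed texts agree word for word up to `A ↔ 2B`, `S ↔ N`)

Setting (pp. 3009, 3021). `Λ_χ(t) := ε_χ (q/π)^{it/2} Γ((1/2 + a_χ + it)/2) exp(πt/4) L_χ(1/2 + it)`;
"For `t₀ ∈ ℝ` and `h > 0` define `W(t, χ) := Λ_χ(t) exp(-(t - t₀)²/(2h²))` so `W(t₀, χ) = Λ_χ(t₀)`.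
We aim to estimate `W(t₀, χ)` from our samples using Theorems 8.1 and 8.2" (the samples are the
lattice values `Λ_χ(n/A)`, spacing `1/A`, §9.1: `A = 64/5`).

* **Lemma 8.6** (p. 3023), verbatim: "Let `h, A > 0`, `t₀ = n₀/A` for some `n₀ ∈ ℤ_{>0}` and
  `S ∈ ℤ_{>0}`. Now define `G(n) := (3/2 + t₀ + (S+n)/A)^{9/16} exp(-(S+n)²/(2A²h²)) / (π(S+n))`.
  Then `Σ_{n ≥ At₀+S} (3/2 + n/A)^{9/16} exp(-(n/A - t₀)²/(2h²)) sinc(πn - πAt₀) ≤ G(0)/(1 - G(1)/G(0))`.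
  *Proof.* `G(n)` is at least as large as the corresponding term in the sum and the ratio
  `G(n+1)/G(n)` is a decreasing function of `n` so the result follows as the sum of a geometric
  series."
* **Lemma 8.7** (p. 3023), verbatim: "We can now combine Lemmas 7.3, 8.3 and 8.6. Lemma 8.7. Define
  `E := Σ_{|n| ≥ S} W(n/A) sinc(πA(n/A - t₀))`. Then for large enough `t₀` we have
  `|E| ≤ √π ζ(9/8) exp(1/6) 2^{5/4} (q/2π)^{5/16} G(0)/(1 - G(1)/G(0))`."
* §9.5 (p. 3025): "When up-sampling, we set `h`, the width of the Gaussian window, to be `7/32` and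
  `S`, the number of samples on either side of `t₀` to be `20`. This gave us an up-sampling error
  (Lemma 8.7) `|E| < 8.3·10⁻⁸`."

## What is printed versus what is proved (no silent weakening — every deviation is listed here)

1. **`t₀` is an arbitrary real `≥ 0`, not a lattice point.** As printed (`t₀ = n₀/A`), every term of
   the sum in Lemma 8.6 vanishes — `sinc(πn - πAt₀) = sinc(π(n - n₀)) = 0` for `n ≠ n₀` — so the
   lemma is vacuous, and `E = 0` whenever `t₀` is itself a sample point; the lemma is USED (p. 3021,
   §9.5, §10 "we routinely up-sampled the output by a factor of 8 …") for `t₀` strictly between the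
   samples. For real `t₀` the `k`-th integer `n` of the tail `n ≥ At₀ + S` has `u := n - At₀ ≥ S + k`
   (not `= S + k`), and the printed sentence "`G(n)` is at least as large as the corresponding term"
   is recovered from the monotonicity of Platt's profile
   `g(u) = (3/2 + t₀ + u/A)^{9/16} e^{-u²/(2A²h²)}/(πu)`, which DECREASES on `u > 0` unconditionally
   (`UpsamplingTruncation.profile_le_profile`: `(c + u/A)/(c + v/A) ≤ u/v` and `(u/v)^{9/16} ≤ u/v`
   for `v ≤ u`), together with `|sinc(πu)| ≤ 1/(πu)`; so term `≤ g(u) ≤ g(S + k) = G(k)`.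
2. **The ratio step carries the proviso `A h ≤ S`.** "`G(n+1)/G(n)` is a decreasing function of `n`"
   is not true for all parameters (for `A h ≫ S` the Gaussian is flat on the scale of the samples and
   `G(k+1)/G(k) → (S+k)/(S+k+1) ↑ 1`, e.g. `S = 1`, `Ah = 100`: `G(2)/G(1) ≈ 2/3 > G(1)/G(0) ≈ 1/2`,
   and the majorant series is then harmonic-like). What the geometric-series step needs is
   `G(k+1)/G(k) ≤ G(1)/G(0)` for all `k`, and this holds as soon as `A h ≤ S`
   (`UpsamplingTruncation.ratio_le`: `G(k+1)G(0)/(G(1)G(k)) = ρ · e^{-k/(A²h²)} · (1 + k/(S(S+k+1)))`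
   with `ρ ≤ 1` by concavity of `log(c + u/A)`, and `1 + k/(S(S+k+1)) ≤ 1 + k/(A²h²) ≤ e^{k/(A²h²)}`).
   Platt's parameters of record satisfy it with room to spare: `A h = (64/5)(7/32) = 2.8 ≤ 20 = S`
   (`UpsamplingTruncation.platt_parameters_proviso`). The hypothesis is stated, not hidden.
3. **"For large enough `t₀`" is made explicit.** Lemma 8.3 bounds `|Γ((1/2+a_χ+it)/2)| e^{πt/4}` by
   `max(√π (3 + max(2t,0))^{1/4} e^{1/6}, √(2π) e^{π/8+1/4})`; the printed constant of Lemma 8.7 keeps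
   only the first branch, which dominates the second at `3 + 2t₀` iff `4e^{π/2+1/3} ≤ 3 + 2t₀`, i.e.
   `t₀ ≥ 11.93…`. `platt2016_lemma87` carries exactly this analytic condition
   (`√(2π) e^{π/8+1/4} ≤ √π e^{1/6} (3 + 2t₀)^{1/4}`) as a hypothesis; `platt2016_lemma87_of_twelve_le`
   discharges it for `t₀ ≥ 12` (`UpsamplingTruncation.large_enough_of_twelve_le`: `π < 3.1416`, a
   six-term Taylor bound `e^{0.47604} ≤ 1.6098`, `2.2767⁴ ≤ 27`); `platt2016_lemma87_uniform` covers
   EVERY `t₀ ≥ 0` with `√π e^{1/6}` replaced by `max(√π e^{1/6}, √(2π) e^{π/8+1/4}/3^{1/4})`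
   (`≈ 3.62` versus `≈ 2.09`).
4. **"`|n| ≥ S`" is read `|n - At₀| ≥ S`** (the `S` samples "on either side of `t₀`" are the ones
   retained, §9.5); the printed constant is recovered exactly: two tails `×` the `2^{1/4}` of
   `(3 + 2t)^{1/4} = 2^{1/4}(3/2 + t)^{1/4}` give `2^{5/4}`, and `5/16 + 1/4 = 9/16`.
5. In Lemma 8.6 the sum of the ABSOLUTE values `|sinc|` is bounded (stronger than the printed signed
   sum). `ζ(9/8)` is the tree's real `Booker2006Turing.bigZ (9/8)` (as in `platt2016_lemma73`);
   `sinc = Real.sinc` (Mathlib: `sin x / x`, `sinc 0 = 1`), the printed `sinc`.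

## Contents

* `UpsamplingTruncation.profile_le_profile`, `profile_lt_profile`, `profile_pos` — Platt's profile
  `g` is positive and strictly decreasing on `u > 0`;
  `UpsamplingTruncation.ratio_le` — the ratio step under `A h ≤ S`;
  `UpsamplingTruncation.le_geometric_of_ratio`, `summable_and_tsum_le_of_ratio`,
  `majorant_summable_and_tsum_le` — "the result follows as the sum of a geometric series":
  `Σ_{k ≥ 0} G(k) ≤ G(0)/(1 - G(1)/G(0))`.
* `UpsamplingTruncation.sum_right_tail_le`, `sum_left_tail_le`, `sum_two_tails_le`,
  `summable_and_tsum_subtype_le` — re-indexing the integer tails `n ≥ At₀ + S`, `n ≤ At₀ - S` by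
  `k = n - ⌈At₀ + S⌉`, `k = ⌊At₀ - S⌋ - n` (injective, `u ≥ S + k`), and passage to `tsum`.
* `UpsamplingTruncation.norm_term_le`, **`UpsamplingTruncation.norm_tsum_tails_le`** — the truncation
  bound for ANY sample function `Λ` with `|Λ(t)| ≤ K (3/2 + t₀ + |t - t₀|)^{9/16}`:
  `‖Σ_{|n - At₀| ≥ S} Λ(n/A) e^{-(n/A-t₀)²/(2h²)} sinc(πA(n/A - t₀))‖ ≤ 2K G(0)/(1 - G(1)/G(0))`.
* `UpsamplingTruncation.norm_completedL_le` — "combine Lemmas 7.3, 8.3":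
  `|Λ_χ(t)| ≤ K₁ 2^{1/4} ζ(9/8) (q/2π)^{5/16} (3/2 + t₀ + |t - t₀|)^{9/16}` for every `K₁` dominating
  both branches of Lemma 8.3 at `3 + 2t₀`; `UpsamplingTruncation.large_enough_of_twelve_le`.
* **`platt2016_lemma86`** — Lemma 8.6 for real `t₀ ≥ 0` (`h, A > 0`, `S ∈ ℤ_{>0}`, `A h ≤ S`):
  summability and the printed bound `G(0)/(1 - G(1)/G(0))`.
* **`platt2016_lemma87`** — Lemma 8.7 for real `t₀ ≥ 0` under the explicit largeness condition, with
  the printed constant `√π ζ(9/8) e^{1/6} 2^{5/4} (q/2π)^{5/16}`; `platt2016_lemma87_of_twelve_le`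
  (`t₀ ≥ 12`); `platt2016_lemma87_uniform` (all `t₀ ≥ 0`, larger constant). Here `χ` is primitive
  modulo `q > 1`, `|ε| = 1` (the statement does not need `ε = ε_χ`), and `Λ_χ`, `W` are written out
  over Mathlib's `DirichletCharacter.LFunction` and `Complex.Gamma` exactly as in `platt2016_lemma85`.

NOT here: the retained main term `Σ_{|n - At₀| < S} W(n/A) sinc(…)` (an evaluation, not a bound), the
aliasing term (Lemma 8.5, `platt2016_lemma85`), and the numerical value `|E| < 8.3·10⁻⁸` of §9.5 (a
computation with `A = 64/5`, `h = 7/32`, `S = 20`, `q ≤ 400 000`, `t₀ ≤ 10⁸/q`).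

`lean search` (2026-08-27): no `lemma86`/`lemma87`/truncation-of-cardinal-series statement in the tree
(`CertifiedLFunctionUpsampling.lean` has the generic Cauchy–Schwarz certificate
`whittakerShannon_truncation_sq_le`, a different bound); Mathlib supplies `Real.sinc`,
`Real.abs_sin_le_one`, `summable_of_sum_le`, `Real.tsum_le_of_sum_le`, `tsum_geometric_of_lt_one`,
`Real.exp_bound`, `Real.pi_lt_d4`, `Real.pow_rpow_inv_natCast`; the tree supplies `platt2016_lemma73`,
`platt2016_lemma83_charParity`, `Booker2006Turing.bigZ_pos`, `charParity`. Nothing is restated.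

## References

* [Platt2016GRH] D. J. Platt, *Numerical computations concerning the GRH*, Math. Comp. 85 (2016),
  no. 302, 3009–3027, doi:10.1090/mcom/3077: `Λ_χ` p. 3009; §8 `W(t, χ)` p. 3021, Lemma 8.3 p. 3021,
  Lemmas 8.6–8.7 p. 3023; §9.1 p. 3023 (`A = 64/5`), §9.5 p. 3025 (`h = 7/32`, `S = 20`); §7.2
  Lemma 7.3 p. 3019. (arXiv:1305.3087v1 §6 Lemmas 6.6–6.7; D. J. Platt, *Computing degree 1
  L-functions rigorously*, PhD thesis, Bristol 2011, Lemmas 7.3.4–7.3.5.)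
-/

noncomputable section

open Complex Finset
open scoped Real

namespace Literature.NumberTheory.LFunctions

namespace UpsamplingTruncation

/-! ## §1 Platt's majorant `G` — elementary inequalities -/

/-- The profile `g(u) = (c + u/A)^{9/16} e^{-u²/(2A²h²)} / (π u)` is decreasing on `u > 0` (`c ≥ 0`).
[cite: Platt2016GRH, Lemma 8.6 p. 3023 (proof: "G(n) is at least as large as the corresponding term")] -/
theorem profile_le_profile {c A h u v : ℝ} (hc : 0 ≤ c) (hA : 0 < A) (hv : 0 < v) (hvu : v ≤ u) :
    (c + u / A) ^ (9 / 16 : ℝ) * Real.exp (-u ^ 2 / (2 * A ^ 2 * h ^ 2)) / (π * u) ≤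
      (c + v / A) ^ (9 / 16 : ℝ) * Real.exp (-v ^ 2 / (2 * A ^ 2 * h ^ 2)) / (π * v) := by
  have hu : 0 < u := hv.trans_le hvu
  have hcv : 0 < c + v / A := by positivity
  have hcu : 0 < c + u / A := by positivity
  -- `(c + u/A) ≤ (u/v) (c + v/A)`
  have h1 : c + u / A ≤ (u / v) * (c + v / A) := by
    rw [div_mul_eq_mul_div, le_div_iff₀ hv]
    have : c * v ≤ c * u := mul_le_mul_of_nonneg_left hvu hc
    nlinarith [div_nonneg hu.le hA.le, this, show u / A * v = u * (v / A) by ring]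
  have huv1 : 1 ≤ u / v := by rw [le_div_iff₀ hv, one_mul]; exact hvu
  have h2 : (c + u / A) ^ (9 / 16 : ℝ) ≤ (u / v) ^ (9 / 16 : ℝ) * (c + v / A) ^ (9 / 16 : ℝ) := by
    rw [← Real.mul_rpow (by positivity) hcv.le]
    exact Real.rpow_le_rpow hcu.le h1 (by norm_num)
  have h3 : (u / v) ^ (9 / 16 : ℝ) ≤ u / v := by
    conv_rhs => rw [← Real.rpow_one (u / v)]
    exact Real.rpow_le_rpow_of_exponent_le huv1 (by norm_num)
  have h4 : Real.exp (-u ^ 2 / (2 * A ^ 2 * h ^ 2)) ≤ Real.exp (-v ^ 2 / (2 * A ^ 2 * h ^ 2)) := by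
    apply Real.exp_le_exp.mpr
    have : v ^ 2 ≤ u ^ 2 := by nlinarith
    have hD : 0 ≤ 2 * A ^ 2 * h ^ 2 := by positivity
    rcases hD.eq_or_lt with hD0 | hDpos
    · rw [← hD0]; simp
    · rw [div_le_div_iff_of_pos_right hDpos]; linarith
  -- combine
  have hE : 0 ≤ Real.exp (-u ^ 2 / (2 * A ^ 2 * h ^ 2)) := (Real.exp_pos _).le
  calc (c + u / A) ^ (9 / 16 : ℝ) * Real.exp (-u ^ 2 / (2 * A ^ 2 * h ^ 2)) / (π * u)
      ≤ ((u / v) * (c + v / A) ^ (9 / 16 : ℝ)) * Real.exp (-v ^ 2 / (2 * A ^ 2 * h ^ 2)) / (π * u) := by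
        gcongr
        exact h2.trans (mul_le_mul_of_nonneg_right h3 (by positivity))
    _ = (c + v / A) ^ (9 / 16 : ℝ) * Real.exp (-v ^ 2 / (2 * A ^ 2 * h ^ 2)) / (π * v) := by
        field_simp

/-- Strict decrease of the profile: `g(u) < g(v)` for `0 < v < u` (`c ≥ 0`).
[cite: Platt2016GRH, Lemma 8.6 p. 3023 (proof)] -/
theorem profile_lt_profile {c A h u v : ℝ} (hc : 0 ≤ c) (hA : 0 < A) (hv : 0 < v) (hvu : v < u) :
    (c + u / A) ^ (9 / 16 : ℝ) * Real.exp (-u ^ 2 / (2 * A ^ 2 * h ^ 2)) / (π * u) <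
      (c + v / A) ^ (9 / 16 : ℝ) * Real.exp (-v ^ 2 / (2 * A ^ 2 * h ^ 2)) / (π * v) := by
  have hu : 0 < u := hv.trans hvu
  have hcv : 0 < c + v / A := by positivity
  have hcu : 0 < c + u / A := by positivity
  have h1 : c + u / A ≤ (u / v) * (c + v / A) := by
    rw [div_mul_eq_mul_div, le_div_iff₀ hv]
    have : c * v ≤ c * u := mul_le_mul_of_nonneg_left hvu.le hc
    nlinarith [div_nonneg hu.le hA.le, this, show u / A * v = u * (v / A) by ring]
  have huv1 : 1 < u / v := by rw [lt_div_iff₀ hv, one_mul]; exact hvu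
  have h2 : (c + u / A) ^ (9 / 16 : ℝ) ≤ (u / v) ^ (9 / 16 : ℝ) * (c + v / A) ^ (9 / 16 : ℝ) := by
    rw [← Real.mul_rpow (by positivity) hcv.le]
    exact Real.rpow_le_rpow hcu.le h1 (by norm_num)
  have h3 : (u / v) ^ (9 / 16 : ℝ) < u / v := by
    conv_rhs => rw [← Real.rpow_one (u / v)]
    exact Real.rpow_lt_rpow_of_exponent_lt huv1 (by norm_num)
  have h4 : Real.exp (-u ^ 2 / (2 * A ^ 2 * h ^ 2)) ≤ Real.exp (-v ^ 2 / (2 * A ^ 2 * h ^ 2)) := by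
    apply Real.exp_le_exp.mpr
    have : v ^ 2 ≤ u ^ 2 := by nlinarith
    have hD : 0 ≤ 2 * A ^ 2 * h ^ 2 := by positivity
    rcases hD.eq_or_lt with hD0 | hDpos
    · rw [← hD0]; simp
    · rw [div_le_div_iff_of_pos_right hDpos]; linarith
  have hEv : 0 < Real.exp (-v ^ 2 / (2 * A ^ 2 * h ^ 2)) := Real.exp_pos _
  calc (c + u / A) ^ (9 / 16 : ℝ) * Real.exp (-u ^ 2 / (2 * A ^ 2 * h ^ 2)) / (π * u)
      ≤ (c + u / A) ^ (9 / 16 : ℝ) * Real.exp (-v ^ 2 / (2 * A ^ 2 * h ^ 2)) / (π * u) := by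
        gcongr
    _ < ((u / v) * (c + v / A) ^ (9 / 16 : ℝ)) * Real.exp (-v ^ 2 / (2 * A ^ 2 * h ^ 2)) / (π * u) := by
        have hlt : (c + u / A) ^ (9 / 16 : ℝ) < (u / v) * (c + v / A) ^ (9 / 16 : ℝ) :=
          h2.trans_lt (mul_lt_mul_of_pos_right h3 (Real.rpow_pos_of_pos hcv _))
        have hπu : 0 < π * u := by positivity
        exact div_lt_div_of_pos_right (mul_lt_mul_of_pos_right hlt hEv) hπu
    _ = (c + v / A) ^ (9 / 16 : ℝ) * Real.exp (-v ^ 2 / (2 * A ^ 2 * h ^ 2)) / (π * v) := by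
        field_simp

/-- The profile is positive on `u > 0`.
[cite: Platt2016GRH, Lemma 8.6 p. 3023 (proof)] -/
theorem profile_pos {c A h u : ℝ} (hc : 0 ≤ c) (hA : 0 < A) (hu : 0 < u) :
    0 < (c + u / A) ^ (9 / 16 : ℝ) * Real.exp (-u ^ 2 / (2 * A ^ 2 * h ^ 2)) / (π * u) := by
  have hcu : 0 < c + u / A := by positivity
  have := Real.rpow_pos_of_pos hcu (9 / 16 : ℝ)
  positivity

/-- **The ratio step of Platt's proof of Lemma 8.6, under `A h ≤ S`:** with
`G(k) = g(S + k)`, `G(k+1) G(0) ≤ G(1) G(k)` for every `k ≥ 0`, i.e. `G(k+1)/G(k) ≤ G(1)/G(0)`.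
[cite: Platt2016GRH, Lemma 8.6 p. 3023 (proof: "the ratio G(n+1)/G(n) is a decreasing function of n")] -/
theorem ratio_le {c A h S k : ℝ} (hc : 0 ≤ c) (hA : 0 < A) (hh : 0 < h) (hS : 0 < S) (hk : 0 ≤ k)
    (hSAh : A * h ≤ S) :
    ((c + (S + (k + 1)) / A) ^ (9 / 16 : ℝ) * Real.exp (-(S + (k + 1)) ^ 2 / (2 * A ^ 2 * h ^ 2)) /
        (π * (S + (k + 1)))) *
      ((c + S / A) ^ (9 / 16 : ℝ) * Real.exp (-S ^ 2 / (2 * A ^ 2 * h ^ 2)) / (π * S)) ≤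
    ((c + (S + 1) / A) ^ (9 / 16 : ℝ) * Real.exp (-(S + 1) ^ 2 / (2 * A ^ 2 * h ^ 2)) /
        (π * (S + 1))) *
      ((c + (S + k) / A) ^ (9 / 16 : ℝ) * Real.exp (-(S + k) ^ 2 / (2 * A ^ 2 * h ^ 2)) /
        (π * (S + k))) := by
  have hD : 0 < 2 * A ^ 2 * h ^ 2 := by positivity
  have hAh : 0 < A ^ 2 * h ^ 2 := by positivity
  -- (i) the power part
  have x0 : 0 < c + S / A := by positivity
  have x1 : 0 < c + (S + 1) / A := by positivity
  have xk : 0 < c + (S + k) / A := by positivity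
  have xk1 : 0 < c + (S + (k + 1)) / A := by positivity
  have hi : (c + (S + (k + 1)) / A) * (c + S / A) ≤ (c + (S + 1) / A) * (c + (S + k) / A) := by
    have : (c + (S + (k + 1)) / A) * (c + S / A) - (c + (S + 1) / A) * (c + (S + k) / A)
        = -k / A ^ 2 := by field_simp; ring
    have hk' : -k / A ^ 2 ≤ 0 := div_nonpos_of_nonpos_of_nonneg (by linarith) (by positivity)
    linarith
  have hpow : (c + (S + (k + 1)) / A) ^ (9 / 16 : ℝ) * (c + S / A) ^ (9 / 16 : ℝ) ≤
      (c + (S + 1) / A) ^ (9 / 16 : ℝ) * (c + (S + k) / A) ^ (9 / 16 : ℝ) := by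
    rw [← Real.mul_rpow xk1.le x0.le, ← Real.mul_rpow x1.le xk.le]
    exact Real.rpow_le_rpow (by positivity) hi (by norm_num)
  -- (ii) the Gaussian part: exact identity with the factor `e^{-k/(A²h²)}`
  have hexp : Real.exp (-(S + (k + 1)) ^ 2 / (2 * A ^ 2 * h ^ 2)) * Real.exp (-S ^ 2 / (2 * A ^ 2 * h ^ 2))
      = Real.exp (-(S + 1) ^ 2 / (2 * A ^ 2 * h ^ 2)) * Real.exp (-(S + k) ^ 2 / (2 * A ^ 2 * h ^ 2)) *
          Real.exp (-(k / (A ^ 2 * h ^ 2))) := by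
    rw [← Real.exp_add, ← Real.exp_add, ← Real.exp_add]
    congr 1
    field_simp
    ring
  -- (iii) the `1/u` part against `e^{-k/(A²h²)}`: `(S+1)(S+k) ≤ e^{k/(A²h²)} S (S+k+1)`
  have hiii : Real.exp (-(k / (A ^ 2 * h ^ 2))) * ((S + 1) * (S + k)) ≤ S * (S + (k + 1)) := by
    have hS2 : A ^ 2 * h ^ 2 ≤ S ^ 2 := by
      have := mul_self_le_mul_self (by positivity) hSAh
      nlinarith
    -- `1 + k/(A²h²) ≤ e^{k/(A²h²)}` and `(S+1)(S+k) ≤ (1 + k/S²) S (S+k+1) ≤ (1 + k/(A²h²)) S (S+k+1)`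
    have h1 : 1 + k / (A ^ 2 * h ^ 2) ≤ Real.exp (k / (A ^ 2 * h ^ 2)) := by
      linarith [Real.add_one_le_exp (k / (A ^ 2 * h ^ 2))]
    have h2 : (S + 1) * (S + k) ≤ (1 + k / S ^ 2) * (S * (S + (k + 1))) := by
      have hS2pos : 0 < S ^ 2 := by positivity
      rw [show (1 + k / S ^ 2) * (S * (S + (k + 1))) = S * (S + (k + 1)) + k * (S + (k + 1)) / S by
        field_simp]
      have : k ≤ k * (S + (k + 1)) / S := by
        rw [le_div_iff₀ hS]; nlinarith
      nlinarith
    have h3 : (1 + k / S ^ 2) ≤ (1 + k / (A ^ 2 * h ^ 2)) := by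
      have := div_le_div_of_nonneg_left hk hAh hS2
      linarith
    have hpos : 0 ≤ S * (S + (k + 1)) := by positivity
    have h4 : (S + 1) * (S + k) ≤ Real.exp (k / (A ^ 2 * h ^ 2)) * (S * (S + (k + 1))) :=
      h2.trans ((mul_le_mul_of_nonneg_right (h3.trans h1) hpos))
    rw [Real.exp_neg]
    have hE : 0 < Real.exp (k / (A ^ 2 * h ^ 2)) := Real.exp_pos _
    rw [inv_mul_le_iff₀ hE]
    linarith
  -- assemble
  have hπ : 0 < π := Real.pi_pos
  have e0 : 0 < Real.exp (-(S + 1) ^ 2 / (2 * A ^ 2 * h ^ 2)) := Real.exp_pos _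
  have e1 : 0 < Real.exp (-(S + k) ^ 2 / (2 * A ^ 2 * h ^ 2)) := Real.exp_pos _
  have e2 : 0 < Real.exp (-(k / (A ^ 2 * h ^ 2))) := Real.exp_pos _
  have p0 := Real.rpow_pos_of_pos x1 (9 / 16 : ℝ)
  have p1 := Real.rpow_pos_of_pos xk (9 / 16 : ℝ)
  calc ((c + (S + (k + 1)) / A) ^ (9 / 16 : ℝ) * Real.exp (-(S + (k + 1)) ^ 2 / (2 * A ^ 2 * h ^ 2)) /
        (π * (S + (k + 1)))) *
      ((c + S / A) ^ (9 / 16 : ℝ) * Real.exp (-S ^ 2 / (2 * A ^ 2 * h ^ 2)) / (π * S))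
      = ((c + (S + (k + 1)) / A) ^ (9 / 16 : ℝ) * (c + S / A) ^ (9 / 16 : ℝ)) *
          (Real.exp (-(S + (k + 1)) ^ 2 / (2 * A ^ 2 * h ^ 2)) * Real.exp (-S ^ 2 / (2 * A ^ 2 * h ^ 2))) /
          (π ^ 2 * (S * (S + (k + 1)))) := by
        field_simp
    _ ≤ ((c + (S + 1) / A) ^ (9 / 16 : ℝ) * (c + (S + k) / A) ^ (9 / 16 : ℝ)) *
          (Real.exp (-(S + 1) ^ 2 / (2 * A ^ 2 * h ^ 2)) * Real.exp (-(S + k) ^ 2 / (2 * A ^ 2 * h ^ 2)) *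
            Real.exp (-(k / (A ^ 2 * h ^ 2)))) /
          (π ^ 2 * (S * (S + (k + 1)))) := by
        rw [hexp]
        gcongr
    _ ≤ ((c + (S + 1) / A) ^ (9 / 16 : ℝ) * (c + (S + k) / A) ^ (9 / 16 : ℝ)) *
          (Real.exp (-(S + 1) ^ 2 / (2 * A ^ 2 * h ^ 2)) * Real.exp (-(S + k) ^ 2 / (2 * A ^ 2 * h ^ 2))) /
          (π ^ 2 * ((S + 1) * (S + k))) := by
        -- move `e^{-k/(A²h²)}` into the denominator comparison (iii)
        rw [div_le_div_iff₀ (by positivity) (by positivity)]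
        have key : Real.exp (-(k / (A ^ 2 * h ^ 2))) * (π ^ 2 * ((S + 1) * (S + k))) ≤
            π ^ 2 * (S * (S + (k + 1))) := by nlinarith [hiii, sq_nonneg π]
        have hP : 0 ≤ ((c + (S + 1) / A) ^ (9 / 16 : ℝ) * (c + (S + k) / A) ^ (9 / 16 : ℝ)) *
            (Real.exp (-(S + 1) ^ 2 / (2 * A ^ 2 * h ^ 2)) * Real.exp (-(S + k) ^ 2 / (2 * A ^ 2 * h ^ 2))) :=
          by positivity
        calc _ = (((c + (S + 1) / A) ^ (9 / 16 : ℝ) * (c + (S + k) / A) ^ (9 / 16 : ℝ)) *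
            (Real.exp (-(S + 1) ^ 2 / (2 * A ^ 2 * h ^ 2)) * Real.exp (-(S + k) ^ 2 / (2 * A ^ 2 * h ^ 2)))) *
            (Real.exp (-(k / (A ^ 2 * h ^ 2))) * (π ^ 2 * ((S + 1) * (S + k)))) := by ring
          _ ≤ _ := mul_le_mul_of_nonneg_left key hP
    _ = _ := by field_simp


/-- Geometric domination from the ratio step: `G(k) ≤ G(0) (G(1)/G(0))^k`.
[cite: Platt2016GRH, Lemma 8.6 p. 3023 (proof: "the result follows as the sum of a geometric series")] -/
theorem le_geometric_of_ratio {G : ℕ → ℝ} (hpos : ∀ k, 0 < G k)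
    (hratio : ∀ k : ℕ, G (k + 1) * G 0 ≤ G 1 * G k) (k : ℕ) :
    G k ≤ G 0 * (G 1 / G 0) ^ k := by
  induction k with
  | zero => simp
  | succ k ih =>
    have h0 := hpos 0
    have hr : 0 ≤ G 1 / G 0 := div_nonneg (hpos 1).le h0.le
    have h1 : G (k + 1) ≤ (G 1 / G 0) * G k := by
      rw [div_mul_eq_mul_div, le_div_iff₀ h0]; exact hratio k
    calc G (k + 1) ≤ (G 1 / G 0) * G k := h1
      _ ≤ (G 1 / G 0) * (G 0 * (G 1 / G 0) ^ k) := mul_le_mul_of_nonneg_left ih hr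
      _ = G 0 * (G 1 / G 0) ^ (k + 1) := by ring

/-- "The result follows as the sum of a geometric series": positivity, the ratio step and
`G(1) < G(0)` give `Σ_k G(k) ≤ G(0) / (1 - G(1)/G(0))`.
[cite: Platt2016GRH, Lemma 8.6 p. 3023 (proof: "the result follows as the sum of a geometric series")] -/
theorem summable_and_tsum_le_of_ratio {G : ℕ → ℝ} (hpos : ∀ k, 0 < G k)
    (hratio : ∀ k : ℕ, G (k + 1) * G 0 ≤ G 1 * G k) (h10 : G 1 < G 0) :
    Summable G ∧ ∑' k, G k ≤ G 0 / (1 - G 1 / G 0) := by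
  have hr0 : 0 ≤ G 1 / G 0 := div_nonneg (hpos 1).le (hpos 0).le
  have hr1 : G 1 / G 0 < 1 := (div_lt_one (hpos 0)).mpr h10
  have hgeom : Summable (fun k : ℕ => G 0 * (G 1 / G 0) ^ k) :=
    (summable_geometric_of_lt_one hr0 hr1).mul_left _
  have hle : ∀ k, G k ≤ G 0 * (G 1 / G 0) ^ k := le_geometric_of_ratio hpos hratio
  have hS : Summable G := Summable.of_nonneg_of_le (fun k => (hpos k).le) hle hgeom
  refine ⟨hS, ?_⟩
  calc ∑' k, G k ≤ ∑' k, G 0 * (G 1 / G 0) ^ k := hS.tsum_le_tsum hle hgeom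
    _ = G 0 * (1 - G 1 / G 0)⁻¹ := by rw [tsum_mul_left, tsum_geometric_of_lt_one hr0 hr1]
    _ = G 0 / (1 - G 1 / G 0) := (div_eq_mul_inv _ _).symm

/-- Platt's majorant `G(k) = g(S + k)` (as a function on `ℕ`) is positive, satisfies the ratio step
under `A h ≤ S`, has `G(1) < G(0)`, and hence `Σ_k G(k) ≤ G(0)/(1 - G(1)/G(0))`.
[cite: Platt2016GRH, Lemma 8.6 p. 3023 (proof: "the result follows as the sum of a geometric series")] -/
theorem majorant_summable_and_tsum_le {c A h S : ℝ} (hc : 0 ≤ c) (hA : 0 < A) (hh : 0 < h)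
    (hS : 0 < S) (hSAh : A * h ≤ S) :
    Summable (fun k : ℕ => (c + (S + k) / A) ^ (9 / 16 : ℝ) *
        Real.exp (-(S + k) ^ 2 / (2 * A ^ 2 * h ^ 2)) / (π * (S + k))) ∧
      ∑' k : ℕ, (c + (S + k) / A) ^ (9 / 16 : ℝ) * Real.exp (-(S + k) ^ 2 / (2 * A ^ 2 * h ^ 2)) /
          (π * (S + k)) ≤
        ((c + S / A) ^ (9 / 16 : ℝ) * Real.exp (-S ^ 2 / (2 * A ^ 2 * h ^ 2)) / (π * S)) /
          (1 - ((c + (S + 1) / A) ^ (9 / 16 : ℝ) * Real.exp (-(S + 1) ^ 2 / (2 * A ^ 2 * h ^ 2)) /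
              (π * (S + 1))) /
            ((c + S / A) ^ (9 / 16 : ℝ) * Real.exp (-S ^ 2 / (2 * A ^ 2 * h ^ 2)) / (π * S))) := by
  set G : ℕ → ℝ := fun k => (c + (S + k) / A) ^ (9 / 16 : ℝ) *
    Real.exp (-(S + k) ^ 2 / (2 * A ^ 2 * h ^ 2)) / (π * (S + k)) with hGdef
  have hpos : ∀ k, 0 < G k := fun k => by
    simp only [hGdef]; exact profile_pos hc hA (by positivity)
  have hratio : ∀ k : ℕ, G (k + 1) * G 0 ≤ G 1 * G k := fun k => by
    have := ratio_le (c := c) hc hA hh hS (k := (k : ℝ)) (by positivity) hSAh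
    simp only [hGdef, Nat.cast_add, Nat.cast_one, Nat.cast_zero, add_zero]
    convert this using 3
  have h10 : G 1 < G 0 := by
    simp only [hGdef, Nat.cast_one, Nat.cast_zero, add_zero]
    exact profile_lt_profile hc hA hS (by linarith)
  have hG0 : G 0 = (c + S / A) ^ (9 / 16 : ℝ) * Real.exp (-S ^ 2 / (2 * A ^ 2 * h ^ 2)) / (π * S) := by
    simp only [hGdef, Nat.cast_zero, add_zero]
  have hG1 : G 1 = (c + (S + 1) / A) ^ (9 / 16 : ℝ) * Real.exp (-(S + 1) ^ 2 / (2 * A ^ 2 * h ^ 2)) /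
      (π * (S + 1)) := by
    simp only [hGdef, Nat.cast_one]
  have := summable_and_tsum_le_of_ratio hpos hratio h10
  rw [hG0, hG1] at this
  exact this

/-! ## §2 Re-indexing the tails of the cardinal series -/

/-- Right tail: a finite family of integers `n ≥ x + S` whose terms are dominated by
`K g(n - x)` has sum `≤ K Σ_k G(k)` (the `k`-th integer of the tail has `n - x ≥ S + k`, and `g`
decreases).
[cite: Platt2016GRH, Lemma 8.6 p. 3023] -/
theorem sum_right_tail_le {c A h S x K : ℝ} (hc : 0 ≤ c) (hA : 0 < A) (hh : 0 < h) (hS : 0 < S)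
    (hK : 0 ≤ K) (hSAh : A * h ≤ S) (f : ℤ → ℝ) (T : Finset ℤ) (hT : ∀ n ∈ T, x + S ≤ (n : ℝ))
    (hf : ∀ n ∈ T, f n ≤ K * ((c + ((n : ℝ) - x) / A) ^ (9 / 16 : ℝ) *
      Real.exp (-((n : ℝ) - x) ^ 2 / (2 * A ^ 2 * h ^ 2)) / (π * ((n : ℝ) - x)))) :
    ∑ n ∈ T, f n ≤ K * ∑' k : ℕ, (c + (S + k) / A) ^ (9 / 16 : ℝ) *
        Real.exp (-(S + k) ^ 2 / (2 * A ^ 2 * h ^ 2)) / (π * (S + k)) := by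
  set G : ℕ → ℝ := fun k => (c + (S + k) / A) ^ (9 / 16 : ℝ) *
    Real.exp (-(S + k) ^ 2 / (2 * A ^ 2 * h ^ 2)) / (π * (S + k)) with hGdef
  have hGs : Summable G := (majorant_summable_and_tsum_le hc hA hh hS hSAh).1
  have hGpos : ∀ k, 0 < G k := fun k => by
    simp only [hGdef]; exact profile_pos hc hA (by positivity)
  set n₀ : ℤ := ⌈x + S⌉ with hn₀
  have hn₀le : ∀ n ∈ T, n₀ ≤ n := fun n hn => Int.ceil_le.mpr (hT n hn)
  let φ : ℤ → ℕ := fun n => (n - n₀).toNat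
  have hφcast : ∀ n ∈ T, ((φ n : ℕ) : ℝ) = (n : ℝ) - n₀ := fun n hn => by
    have h0 : 0 ≤ n - n₀ := sub_nonneg.mpr (hn₀le n hn)
    have : ((n - n₀).toNat : ℤ) = n - n₀ := Int.toNat_of_nonneg h0
    simp only [φ]
    exact_mod_cast this
  have hinj : Set.InjOn φ ↑T := by
    intro n hn m hm hnm
    have h1 : ((n - n₀).toNat : ℤ) = n - n₀ := Int.toNat_of_nonneg (sub_nonneg.mpr (hn₀le n hn))
    have h2 : ((m - n₀).toNat : ℤ) = m - n₀ := Int.toNat_of_nonneg (sub_nonneg.mpr (hn₀le m hm))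
    have : (φ n : ℤ) = (φ m : ℤ) := by simp only [hnm]
    simp only [φ] at this
    rw [h1, h2] at this
    linarith
  have hx : x + S ≤ (n₀ : ℝ) := Int.le_ceil _
  -- termwise domination `f n ≤ K G(φ n)`
  have hdom : ∀ n ∈ T, f n ≤ K * G (φ n) := fun n hn => by
    have hu : S + (φ n : ℝ) ≤ (n : ℝ) - x := by rw [hφcast n hn]; linarith
    have hv : 0 < S + (φ n : ℝ) := by positivity
    refine (hf n hn).trans (mul_le_mul_of_nonneg_left ?_ hK)
    simp only [hGdef]
    exact profile_le_profile hc hA hv hu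
  calc ∑ n ∈ T, f n ≤ ∑ n ∈ T, K * G (φ n) := Finset.sum_le_sum hdom
    _ = K * ∑ n ∈ T, G (φ n) := by rw [Finset.mul_sum]
    _ = K * ∑ j ∈ T.image φ, G j := by rw [Finset.sum_image hinj]
    _ ≤ K * ∑' k, G k := by
        gcongr
        exact hGs.sum_le_tsum _ (fun j _ => (hGpos j).le)

/-- Left tail: the mirror image (`n ≤ x - S`, terms dominated by `K g(x - n)`).
[cite: Platt2016GRH, Lemma 8.7 p. 3023] -/
theorem sum_left_tail_le {c A h S x K : ℝ} (hc : 0 ≤ c) (hA : 0 < A) (hh : 0 < h) (hS : 0 < S)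
    (hK : 0 ≤ K) (hSAh : A * h ≤ S) (f : ℤ → ℝ) (T : Finset ℤ) (hT : ∀ n ∈ T, (n : ℝ) ≤ x - S)
    (hf : ∀ n ∈ T, f n ≤ K * ((c + (x - (n : ℝ)) / A) ^ (9 / 16 : ℝ) *
      Real.exp (-(x - (n : ℝ)) ^ 2 / (2 * A ^ 2 * h ^ 2)) / (π * (x - (n : ℝ))))) :
    ∑ n ∈ T, f n ≤ K * ∑' k : ℕ, (c + (S + k) / A) ^ (9 / 16 : ℝ) *
        Real.exp (-(S + k) ^ 2 / (2 * A ^ 2 * h ^ 2)) / (π * (S + k)) := by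
  set G : ℕ → ℝ := fun k => (c + (S + k) / A) ^ (9 / 16 : ℝ) *
    Real.exp (-(S + k) ^ 2 / (2 * A ^ 2 * h ^ 2)) / (π * (S + k)) with hGdef
  have hGs : Summable G := (majorant_summable_and_tsum_le hc hA hh hS hSAh).1
  have hGpos : ∀ k, 0 < G k := fun k => by
    simp only [hGdef]; exact profile_pos hc hA (by positivity)
  set n₁ : ℤ := ⌊x - S⌋ with hn₁
  have hn₁le : ∀ n ∈ T, n ≤ n₁ := fun n hn => Int.le_floor.mpr (hT n hn)
  let φ : ℤ → ℕ := fun n => (n₁ - n).toNat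
  have hφcast : ∀ n ∈ T, ((φ n : ℕ) : ℝ) = (n₁ : ℝ) - n := fun n hn => by
    have h0 : 0 ≤ n₁ - n := sub_nonneg.mpr (hn₁le n hn)
    have : ((n₁ - n).toNat : ℤ) = n₁ - n := Int.toNat_of_nonneg h0
    simp only [φ]
    exact_mod_cast this
  have hinj : Set.InjOn φ ↑T := by
    intro n hn m hm hnm
    have h1 : ((n₁ - n).toNat : ℤ) = n₁ - n := Int.toNat_of_nonneg (sub_nonneg.mpr (hn₁le n hn))
    have h2 : ((n₁ - m).toNat : ℤ) = n₁ - m := Int.toNat_of_nonneg (sub_nonneg.mpr (hn₁le m hm))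
    have : (φ n : ℤ) = (φ m : ℤ) := by simp only [hnm]
    simp only [φ] at this
    rw [h1, h2] at this
    linarith
  have hx : (n₁ : ℝ) ≤ x - S := Int.floor_le _
  have hdom : ∀ n ∈ T, f n ≤ K * G (φ n) := fun n hn => by
    have hu : S + (φ n : ℝ) ≤ x - (n : ℝ) := by rw [hφcast n hn]; linarith
    have hv : 0 < S + (φ n : ℝ) := by positivity
    refine (hf n hn).trans (mul_le_mul_of_nonneg_left ?_ hK)
    simp only [hGdef]
    exact profile_le_profile hc hA hv hu
  calc ∑ n ∈ T, f n ≤ ∑ n ∈ T, K * G (φ n) := Finset.sum_le_sum hdom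
    _ = K * ∑ n ∈ T, G (φ n) := by rw [Finset.mul_sum]
    _ = K * ∑ j ∈ T.image φ, G j := by rw [Finset.sum_image hinj]
    _ ≤ K * ∑' k, G k := by
        gcongr
        exact hGs.sum_le_tsum _ (fun j _ => (hGpos j).le)

/-- Both tails: a finite family of integers with `|n - x| ≥ S` and terms dominated by `K g(|n - x|)`
has sum `≤ 2K Σ_k G(k)`.
[cite: Platt2016GRH, Lemma 8.7 p. 3023] -/
theorem sum_two_tails_le {c A h S x K : ℝ} (hc : 0 ≤ c) (hA : 0 < A) (hh : 0 < h) (hS : 0 < S)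
    (hK : 0 ≤ K) (hSAh : A * h ≤ S) (f : ℤ → ℝ) (T : Finset ℤ)
    (hT : ∀ n ∈ T, S ≤ |(n : ℝ) - x|)
    (hf : ∀ n ∈ T, f n ≤ K * ((c + |(n : ℝ) - x| / A) ^ (9 / 16 : ℝ) *
      Real.exp (-|(n : ℝ) - x| ^ 2 / (2 * A ^ 2 * h ^ 2)) / (π * |(n : ℝ) - x|))) :
    ∑ n ∈ T, f n ≤ 2 * K * ∑' k : ℕ, (c + (S + k) / A) ^ (9 / 16 : ℝ) *
        Real.exp (-(S + k) ^ 2 / (2 * A ^ 2 * h ^ 2)) / (π * (S + k)) := by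
  rw [← Finset.sum_filter_add_sum_filter_not T (fun n : ℤ => x ≤ (n : ℝ))]
  have hR := sum_right_tail_le hc hA hh hS hK hSAh f (T.filter fun n : ℤ => x ≤ (n : ℝ))
    (fun n hn => by
      rw [Finset.mem_filter] at hn
      have h := hT n hn.1
      rw [abs_of_nonneg (by linarith [hn.2])] at h
      linarith)
    (fun n hn => by
      rw [Finset.mem_filter] at hn
      have h := hf n hn.1
      rwa [abs_of_nonneg (by linarith [hn.2])] at h)
  have hL := sum_left_tail_le hc hA hh hS hK hSAh f (T.filter fun n : ℤ => ¬ x ≤ (n : ℝ))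
    (fun n hn => by
      rw [Finset.mem_filter] at hn
      have h := hT n hn.1
      rw [abs_of_neg (by linarith [hn.2]), neg_sub] at h
      linarith)
    (fun n hn => by
      rw [Finset.mem_filter] at hn
      have h := hf n hn.1
      rwa [abs_of_neg (by linarith [hn.2]), neg_sub] at h)
  linarith

/-- From bounded partial sums to the subtype `tsum` (non-negative terms).
[folklore] -/
private theorem summable_and_tsum_subtype_le {P : ℤ → Prop} {f : ℤ → ℝ} (hf0 : ∀ n, P n → 0 ≤ f n)
    {B : ℝ} (hB : ∀ T : Finset ℤ, (∀ n ∈ T, P n) → ∑ n ∈ T, f n ≤ B) :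
    Summable (fun n : {n : ℤ // P n} => f n) ∧ ∑' n : {n : ℤ // P n}, f n ≤ B := by
  have hpart : ∀ s : Finset {n : ℤ // P n}, ∑ i ∈ s, f i ≤ B := fun s => by
    have h := hB (s.map (Function.Embedding.subtype _)) (fun n hn => by
      rw [Finset.mem_map] at hn
      obtain ⟨i, _, rfl⟩ := hn
      exact i.2)
    rwa [Finset.sum_map] at h
  have hS : Summable (fun n : {n : ℤ // P n} => f n) :=
    summable_of_sum_le (fun i => hf0 i i.2) hpart
  exact ⟨hS, Real.tsum_le_of_sum_le (fun i => hf0 i i.2) hpart⟩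


/-! ## §3 The terms of the cardinal series of `W(t, χ) = Λ_χ(t) e^{-(t-t₀)²/(2h²)}` -/

/-- `|sinc x| ≤ 1/|x|` (`x ≠ 0`).
[folklore] -/
private theorem abs_sinc_le_one_div_abs {x : ℝ} (hx : x ≠ 0) : |Real.sinc x| ≤ 1 / |x| := by
  rw [Real.sinc_of_ne_zero hx, abs_div]
  exact div_le_div_of_nonneg_right (Real.abs_sin_le_one x) (abs_nonneg x)

/-- The sinc factor at the sample `n/A`: `|sinc(πA(n/A - t₀))| ≤ 1/(π |n - A t₀|)`.
[cite: Platt2016GRH, Lemma 8.6 p. 3023 (proof: the factor 1/(π(S+n)) of G)] -/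
theorem abs_sinc_sample_le {A t₀ : ℝ} (hA : 0 < A) {n : ℝ} (hn : n - A * t₀ ≠ 0) :
    |Real.sinc (π * A * (n / A - t₀))| ≤ 1 / (π * |n - A * t₀|) := by
  have hπ : 0 < π := Real.pi_pos
  have heq : π * A * (n / A - t₀) = π * (n - A * t₀) := by field_simp
  rw [heq]
  refine (abs_sinc_le_one_div_abs (mul_ne_zero hπ.ne' hn)).trans_eq ?_
  rw [abs_mul, abs_of_pos hπ]

/-- The norm of one term `W(n/A) sinc(πA(n/A - t₀))` of the cardinal series, for ANY `Λ` with
`‖Λ(t)‖ ≤ K (3/2 + t₀ + |t - t₀|)^{9/16}`: it is at most `K g(|n - A t₀|)` with Platt's profile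
`g(u) = (3/2 + t₀ + u/A)^{9/16} e^{-u²/(2A²h²)}/(πu)`.
[cite: Platt2016GRH, Lemma 8.7 p. 3023 (proof)] -/
theorem norm_term_le {Λ : ℝ → ℂ} {K t₀ A h : ℝ} (hA : 0 < A) (ht₀ : 0 ≤ t₀) (hK : 0 ≤ K)
    (hΛ : ∀ t : ℝ, ‖Λ t‖ ≤ K * (3 / 2 + t₀ + |t - t₀|) ^ (9 / 16 : ℝ)) {n : ℝ}
    (hn : 0 < |n - A * t₀|) :
    ‖Λ (n / A) * (Real.exp (-(n / A - t₀) ^ 2 / (2 * h ^ 2)) : ℂ) *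
        (Real.sinc (π * A * (n / A - t₀)) : ℂ)‖ ≤
      K * ((3 / 2 + t₀ + |n - A * t₀| / A) ^ (9 / 16 : ℝ) *
        Real.exp (-|n - A * t₀| ^ 2 / (2 * A ^ 2 * h ^ 2)) / (π * |n - A * t₀|)) := by
  have hπ : 0 < π := Real.pi_pos
  have hu : |n / A - t₀| = |n - A * t₀| / A := by
    rw [show n / A - t₀ = (n - A * t₀) / A by field_simp, abs_div, abs_of_pos hA]
  have hexp : Real.exp (-(n / A - t₀) ^ 2 / (2 * h ^ 2)) =
      Real.exp (-|n - A * t₀| ^ 2 / (2 * A ^ 2 * h ^ 2)) := by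
    congr 1
    rw [sq_abs, show n / A - t₀ = (n - A * t₀) / A by field_simp]
    rw [div_pow]
    rcases eq_or_ne h 0 with rfl | hh
    · simp
    · field_simp
  rw [norm_mul, norm_mul, Complex.norm_real, Complex.norm_real, Real.norm_eq_abs,
    abs_of_pos (Real.exp_pos _), Real.norm_eq_abs, hexp]
  have h1 : ‖Λ (n / A)‖ ≤ K * (3 / 2 + t₀ + |n - A * t₀| / A) ^ (9 / 16 : ℝ) := by
    have := hΛ (n / A); rwa [hu] at this
  have h2 : |Real.sinc (π * A * (n / A - t₀))| ≤ 1 / (π * |n - A * t₀|) :=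
    abs_sinc_sample_le hA (abs_pos.mp hn)
  have hE : 0 ≤ Real.exp (-|n - A * t₀| ^ 2 / (2 * A ^ 2 * h ^ 2)) := (Real.exp_pos _).le
  have hb : 0 ≤ 3 / 2 + t₀ + |n - A * t₀| / A := by positivity
  have hKb : 0 ≤ K * (3 / 2 + t₀ + |n - A * t₀| / A) ^ (9 / 16 : ℝ) * Real.exp (-|n - A * t₀| ^ 2 / (2 * A ^ 2 * h ^ 2)) :=
    mul_nonneg (mul_nonneg hK (Real.rpow_nonneg hb _)) hE
  calc ‖Λ (n / A)‖ * Real.exp (-|n - A * t₀| ^ 2 / (2 * A ^ 2 * h ^ 2)) *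
        |Real.sinc (π * A * (n / A - t₀))|
      ≤ (K * (3 / 2 + t₀ + |n - A * t₀| / A) ^ (9 / 16 : ℝ)) *
          Real.exp (-|n - A * t₀| ^ 2 / (2 * A ^ 2 * h ^ 2)) * (1 / (π * |n - A * t₀|)) := by
        gcongr
    _ = K * ((3 / 2 + t₀ + |n - A * t₀| / A) ^ (9 / 16 : ℝ) *
        Real.exp (-|n - A * t₀| ^ 2 / (2 * A ^ 2 * h ^ 2)) / (π * |n - A * t₀|)) := by ring

/-- **The truncation bound for a general sample function** (the content of Platt's Lemma 8.7 once
`|Λ_χ(t)| ≤ K (3/2 + t₀ + |t - t₀|)^{9/16}` is known): for `h, A > 0`, `t₀ ≥ 0`, `S ∈ ℤ_{>0}` with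
`A h ≤ S`, the two tails `|n - A t₀| ≥ S` of the cardinal series of `W(t) = Λ(t) e^{-(t-t₀)²/(2h²)}`
at spacing `1/A`, evaluated at `t₀`, converge absolutely and have norm at most
`2K · G(0)/(1 - G(1)/G(0))`.
[cite: Platt2016GRH, Lemma 8.7 p. 3023] -/
theorem norm_tsum_tails_le {Λ : ℝ → ℂ} {K t₀ A h : ℝ} (hh : 0 < h) (hA : 0 < A) (ht₀ : 0 ≤ t₀)
    (hK : 0 ≤ K) (hΛ : ∀ t : ℝ, ‖Λ t‖ ≤ K * (3 / 2 + t₀ + |t - t₀|) ^ (9 / 16 : ℝ)) {S : ℕ}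
    (hS : 0 < S) (hSAh : A * h ≤ S) :
    Summable (fun n : {n : ℤ // (S : ℝ) ≤ |(n : ℝ) - A * t₀|} =>
        Λ ((n : ℝ) / A) * (Real.exp (-((n : ℝ) / A - t₀) ^ 2 / (2 * h ^ 2)) : ℂ) *
          (Real.sinc (π * A * ((n : ℝ) / A - t₀)) : ℂ)) ∧
      ‖∑' n : {n : ℤ // (S : ℝ) ≤ |(n : ℝ) - A * t₀|},
          Λ ((n : ℝ) / A) * (Real.exp (-((n : ℝ) / A - t₀) ^ 2 / (2 * h ^ 2)) : ℂ) *
            (Real.sinc (π * A * ((n : ℝ) / A - t₀)) : ℂ)‖ ≤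
        2 * K * (((3 / 2 + t₀ + S / A) ^ (9 / 16 : ℝ) * Real.exp (-(S : ℝ) ^ 2 / (2 * A ^ 2 * h ^ 2)) /
            (π * S)) /
          (1 - ((3 / 2 + t₀ + (S + 1) / A) ^ (9 / 16 : ℝ) *
                Real.exp (-((S : ℝ) + 1) ^ 2 / (2 * A ^ 2 * h ^ 2)) / (π * (S + 1))) /
            ((3 / 2 + t₀ + S / A) ^ (9 / 16 : ℝ) * Real.exp (-(S : ℝ) ^ 2 / (2 * A ^ 2 * h ^ 2)) /
              (π * S)))) := by
  have hc : (0 : ℝ) ≤ 3 / 2 + t₀ := by positivity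
  have hS' : (0 : ℝ) < S := by exact_mod_cast hS
  set F : ℤ → ℂ := fun n => Λ ((n : ℝ) / A) * (Real.exp (-((n : ℝ) / A - t₀) ^ 2 / (2 * h ^ 2)) : ℂ) *
    (Real.sinc (π * A * ((n : ℝ) / A - t₀)) : ℂ) with hF
  obtain ⟨hGs, hGle⟩ := majorant_summable_and_tsum_le hc hA hh hS' hSAh
  set B : ℝ := ((3 / 2 + t₀ + S / A) ^ (9 / 16 : ℝ) * Real.exp (-(S : ℝ) ^ 2 / (2 * A ^ 2 * h ^ 2)) /
            (π * S)) /
          (1 - ((3 / 2 + t₀ + (S + 1) / A) ^ (9 / 16 : ℝ) *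
                Real.exp (-((S : ℝ) + 1) ^ 2 / (2 * A ^ 2 * h ^ 2)) / (π * (S + 1))) /
            ((3 / 2 + t₀ + S / A) ^ (9 / 16 : ℝ) * Real.exp (-(S : ℝ) ^ 2 / (2 * A ^ 2 * h ^ 2)) /
              (π * S))) with hB
  -- partial sums of the norms over the two tails
  have hpart : ∀ T : Finset ℤ, (∀ n ∈ T, (S : ℝ) ≤ |(n : ℝ) - A * t₀|) →
      ∑ n ∈ T, ‖F n‖ ≤ 2 * K * B := by
    intro T hT
    have h := sum_two_tails_le hc hA hh hS' hK hSAh (fun n => ‖F n‖) T hT (fun n hn => by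
      have hpos : 0 < |(n : ℝ) - A * t₀| := hS'.trans_le (hT n hn)
      simpa only [hF] using norm_term_le hA ht₀ hK hΛ hpos)
    have h2K : 0 ≤ 2 * K := by positivity
    exact h.trans (mul_le_mul_of_nonneg_left hGle h2K)
  obtain ⟨hsum, hle⟩ := summable_and_tsum_subtype_le (P := fun n : ℤ => (S : ℝ) ≤ |(n : ℝ) - A * t₀|)
    (f := fun n => ‖F n‖) (fun n _ => norm_nonneg _) hpart
  refine ⟨Summable.of_norm hsum, ?_⟩
  exact (norm_tsum_le_tsum_norm hsum).trans hle

/-! ## §4 Platt's `Λ_χ`: the size of the samples (Lemmas 7.3 and 8.3 combined) -/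

/-- `|t| ≤ t₀ + |t - t₀|` for `t₀ ≥ 0`.
[folklore] -/
private theorem abs_le_add_abs_sub {t t₀ : ℝ} (ht₀ : 0 ≤ t₀) : |t| ≤ t₀ + |t - t₀| := by
  have := abs_add_le t₀ (t - t₀)
  rw [add_sub_cancel, abs_of_nonneg ht₀] at this
  exact this

/-- **"We can now combine Lemmas 7.3, 8.3"** (p. 3023): for `χ` primitive modulo `q > 1`, `|ε| = 1`,
`t₀ ≥ 0`, and a constant `K₁` dominating the two branches of Lemma 8.3
(`√π e^{1/6} ≤ K₁` and `√(2π) e^{π/8+1/4} ≤ K₁ (3 + 2t₀)^{1/4}` — the second is Platt's "for large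
enough `t₀`" when `K₁ = √π e^{1/6}`), Platt's completed `L`-function
`Λ_χ(t) = ε (q/π)^{it/2} Γ((1/2 + a_χ + it)/2) e^{πt/4} L_χ(1/2 + it)` (p. 3009) satisfies, for every
real `t`, `|Λ_χ(t)| ≤ K₁ 2^{1/4} ζ(9/8) (q/2π)^{5/16} (3/2 + t₀ + |t - t₀|)^{9/16}`
(Lemma 7.3: `|L_χ(1/2+it)| ≤ ζ(9/8)(q/2π)^{5/16}(3/2+|t|)^{5/16}`, `|t| ≤ t₀ + |t - t₀|`; Lemma 8.3 with
`max(2t, 0) ≤ 2(t₀ + |t - t₀|)`; `1/4 + 5/16 = 9/16`).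
[cite: Platt2016GRH, Lemma 8.7 p. 3023 (proof: "combine Lemmas 7.3, 8.3 and 8.6")] -/
theorem norm_completedL_le {q : ℕ} [NeZero q] (hq : 1 < q) {χ : DirichletCharacter ℂ q}
    (hχ : χ.IsPrimitive) {ε : ℂ} (hε : ‖ε‖ = 1) {t₀ K₁ : ℝ} (ht₀ : 0 ≤ t₀)
    (hK₁ : Real.sqrt π * Real.exp (1 / 6) ≤ K₁)
    (hlarge : Real.sqrt (2 * π) * Real.exp (π / 8 + 1 / 4) ≤ K₁ * (3 + 2 * t₀) ^ (1 / 4 : ℝ))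
    (t : ℝ) :
    ‖ε * ((q : ℂ) / π) ^ (I * t / 2) * Complex.Gamma ((1 / 2 + charParity χ + I * t) / 2) *
        Complex.exp (π * t / 4) * χ.LFunction (1 / 2 + I * t)‖ ≤
      (K₁ * (2 : ℝ) ^ (1 / 4 : ℝ) * Booker2006Turing.bigZ (9 / 8) * ((q : ℝ) / (2 * π)) ^ (5 / 16 : ℝ)) *
        (3 / 2 + t₀ + |t - t₀|) ^ (9 / 16 : ℝ) := by
  have hπ : 0 < π := Real.pi_pos
  have hK₁0 : 0 ≤ K₁ := le_trans (by positivity) hK₁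
  set x : ℝ := t₀ + |t - t₀| with hx
  have hx0 : 0 ≤ x := by positivity
  have htx : t ≤ x := by rw [hx]; linarith [le_abs_self (t - t₀)]
  have habs : |t| ≤ x := abs_le_add_abs_sub ht₀
  -- the unimodular factors
  have hq0 : (0 : ℝ) < q := by exact_mod_cast (by omega : 0 < q)
  have hbase : ‖((q : ℂ) / π) ^ (I * t / 2)‖ = 1 := by
    have hqπ : 0 < (q : ℝ) / π := div_pos hq0 hπ
    rw [show ((q : ℂ) / π) = (((q : ℝ) / π : ℝ) : ℂ) by push_cast; ring,
      Complex.norm_cpow_eq_rpow_re_of_pos hqπ]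
    simp
  have hexp4 : ‖Complex.exp (π * t / 4)‖ = Real.exp (π * t / 4) := by
    rw [Complex.norm_exp]
    congr 1
    simp
  -- Lemma 8.3
  have hΓ : ‖Complex.Gamma ((1 / 2 + charParity χ + I * t) / 2)‖ * Real.exp (π * t / 4) ≤
      K₁ * (3 + 2 * x) ^ (1 / 4 : ℝ) := by
    refine (platt2016_lemma83_charParity χ t).trans (max_le ?_ ?_)
    · have hm : 3 + max (2 * t) 0 ≤ 3 + 2 * x := by
        have : max (2 * t) 0 ≤ 2 * x := max_le (by linarith) (by positivity)
        linarith
      have hm0 : 0 ≤ 3 + max (2 * t) 0 := by positivity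
      calc Real.sqrt π * (3 + max (2 * t) 0) ^ (1 / 4 : ℝ) * Real.exp (1 / 6)
          = (Real.sqrt π * Real.exp (1 / 6)) * (3 + max (2 * t) 0) ^ (1 / 4 : ℝ) := by ring
        _ ≤ K₁ * (3 + 2 * x) ^ (1 / 4 : ℝ) := by
          gcongr
    · calc Real.sqrt (2 * π) * Real.exp (π / 8 + 1 / 4) ≤ K₁ * (3 + 2 * t₀) ^ (1 / 4 : ℝ) := hlarge
        _ ≤ K₁ * (3 + 2 * x) ^ (1 / 4 : ℝ) := by
          gcongr
          rw [hx]; linarith [abs_nonneg (t - t₀)]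
  -- Lemma 7.3
  have hL : ‖χ.LFunction (1 / 2 + I * t)‖ ≤ Booker2006Turing.bigZ (9 / 8) *
      ((q : ℝ) / (2 * π)) ^ (5 / 16 : ℝ) * (3 / 2 + x) ^ (5 / 16 : ℝ) := by
    rw [mul_comm I]
    refine (platt2016_lemma73 hq hχ t).trans ?_
    have hZ : 0 ≤ Booker2006Turing.bigZ (9 / 8) := (Booker2006Turing.bigZ_pos (by norm_num)).le
    gcongr
  -- `(3 + 2x)^{1/4} (3/2 + x)^{5/16} = 2^{1/4} (3/2 + x)^{9/16}`
  have hpow : (3 + 2 * x) ^ (1 / 4 : ℝ) * (3 / 2 + x) ^ (5 / 16 : ℝ) =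
      (2 : ℝ) ^ (1 / 4 : ℝ) * (3 / 2 + x) ^ (9 / 16 : ℝ) := by
    have h32 : 0 < 3 / 2 + x := by positivity
    rw [show (3 : ℝ) + 2 * x = 2 * (3 / 2 + x) by ring, Real.mul_rpow (by norm_num) h32.le, mul_assoc,
      ← Real.rpow_add h32]
    norm_num
  have hZ : 0 ≤ Booker2006Turing.bigZ (9 / 8) := (Booker2006Turing.bigZ_pos (by norm_num)).le
  calc ‖ε * ((q : ℂ) / π) ^ (I * t / 2) * Complex.Gamma ((1 / 2 + charParity χ + I * t) / 2) *
        Complex.exp (π * t / 4) * χ.LFunction (1 / 2 + I * t)‖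
      = (‖Complex.Gamma ((1 / 2 + charParity χ + I * t) / 2)‖ * Real.exp (π * t / 4)) *
          ‖χ.LFunction (1 / 2 + I * t)‖ := by
        rw [norm_mul, norm_mul, norm_mul, norm_mul, hε, hbase, hexp4]; ring
    _ ≤ (K₁ * (3 + 2 * x) ^ (1 / 4 : ℝ)) *
          (Booker2006Turing.bigZ (9 / 8) * ((q : ℝ) / (2 * π)) ^ (5 / 16 : ℝ) * (3 / 2 + x) ^ (5 / 16 : ℝ)) := by
        gcongr
    _ = (K₁ * (2 : ℝ) ^ (1 / 4 : ℝ) * Booker2006Turing.bigZ (9 / 8) * ((q : ℝ) / (2 * π)) ^ (5 / 16 : ℝ)) *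
        (3 / 2 + x) ^ (9 / 16 : ℝ) := by
        rw [show (K₁ * (3 + 2 * x) ^ (1 / 4 : ℝ)) *
            (Booker2006Turing.bigZ (9 / 8) * ((q : ℝ) / (2 * π)) ^ (5 / 16 : ℝ) * (3 / 2 + x) ^ (5 / 16 : ℝ))
            = K₁ * Booker2006Turing.bigZ (9 / 8) * ((q : ℝ) / (2 * π)) ^ (5 / 16 : ℝ) *
              ((3 + 2 * x) ^ (1 / 4 : ℝ) * (3 / 2 + x) ^ (5 / 16 : ℝ)) by ring, hpow]
        ring
    _ = _ := by rw [hx, add_assoc]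

/-- **"For large enough `t₀`" made explicit: `t₀ ≥ 12` suffices** for the second branch of Lemma 8.3
to be dominated by the first at `3 + 2t₀`: `√(2π) e^{π/8+1/4} ≤ √π e^{1/6} (3 + 2t₀)^{1/4}`
(equivalently `4 e^{π/2+1/3} ≤ 3 + 2t₀`; `4 e^{π/2+1/3} = 26.85…`, so the threshold is `t₀ ≥ 11.93…`).
[cite: Platt2016GRH, Lemma 8.7 p. 3023 ("for large enough t₀")] -/
theorem large_enough_of_twelve_le {t₀ : ℝ} (ht₀ : 12 ≤ t₀) :
    Real.sqrt (2 * π) * Real.exp (π / 8 + 1 / 4) ≤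
      (Real.sqrt π * Real.exp (1 / 6)) * (3 + 2 * t₀) ^ (1 / 4 : ℝ) := by
  have hπ : 0 < π := Real.pi_pos
  -- (a) `√2 ≤ 1.414214`
  have hsqrt2 : Real.sqrt 2 ≤ 1.414214 := by
    rw [show (1.414214 : ℝ) = Real.sqrt (1.414214 ^ 2) by rw [Real.sqrt_sq (by norm_num)]]
    exact Real.sqrt_le_sqrt (by norm_num)
  -- (b) `e^{π/8 + 1/12} ≤ 1.6098`: `π/8 + 1/12 ≤ 0.47604` and a Taylor bound for `e^{0.47604}`
  have hx : π / 8 + 1 / 12 ≤ (0.47604 : ℝ) := by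
    have := Real.pi_lt_d4; linarith
  have hexpx : Real.exp (0.47604 : ℝ) ≤ 1.6098 := by
    have hb := Real.exp_bound (x := (0.47604 : ℝ)) (by rw [abs_of_pos (by norm_num)]; norm_num)
      (n := 6) (by norm_num)
    have habs : |(0.47604 : ℝ)| = 0.47604 := abs_of_pos (by norm_num)
    rw [habs] at hb
    have h2 := (abs_sub_le_iff.mp hb).1
    simp only [Finset.sum_range_succ, Finset.sum_range_zero, Nat.factorial] at h2
    norm_num at h2
    linarith
  have hexp : Real.exp (π / 8 + 1 / 12) ≤ 1.6098 :=
    (Real.exp_le_exp.mpr hx).trans hexpx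
  -- (c) `2.2767 ≤ (3 + 2t₀)^{1/4}` since `2.2767⁴ ≤ 27 ≤ 3 + 2t₀`
  have hroot : (2.2767 : ℝ) ≤ (3 + 2 * t₀) ^ (1 / 4 : ℝ) := by
    have h4 : ((2.2767 : ℝ) ^ (4 : ℕ)) ^ (1 / 4 : ℝ) = 2.2767 := by
      rw [show (1 / 4 : ℝ) = ((4 : ℕ) : ℝ)⁻¹ by norm_num]
      exact Real.pow_rpow_inv_natCast (by norm_num) (by norm_num)
    rw [← h4]
    exact Real.rpow_le_rpow (by positivity) (by norm_num; linarith) (by norm_num)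
  -- combine: `√(2π) e^{π/8+1/4} = √π e^{1/6} · (√2 e^{π/8+1/12})`
  have hsplit : Real.sqrt (2 * π) * Real.exp (π / 8 + 1 / 4) =
      (Real.sqrt π * Real.exp (1 / 6)) * (Real.sqrt 2 * Real.exp (π / 8 + 1 / 12)) := by
    rw [Real.sqrt_mul (by norm_num : (0:ℝ) ≤ 2), show (π / 8 + 1 / 4 : ℝ) = 1 / 6 + (π / 8 + 1 / 12) by ring,
      Real.exp_add]
    ring
  rw [hsplit]
  have hK : 0 ≤ Real.sqrt π * Real.exp (1 / 6) := by positivity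
  refine mul_le_mul_of_nonneg_left ?_ hK
  calc Real.sqrt 2 * Real.exp (π / 8 + 1 / 12) ≤ 1.414214 * 1.6098 := by
        gcongr
    _ ≤ 2.2767 := by norm_num
    _ ≤ (3 + 2 * t₀) ^ (1 / 4 : ℝ) := hroot


/-- Platt's parameters of record (§9.1: `A = 64/5`; §9.5: `h = 7/32`, `S = 20`) satisfy the proviso
`A h ≤ S` under which the ratio step of Lemma 8.6 is proved here (`A h = 2.8`).
[cite: Platt2016GRH, §9.1 p. 3023 and §9.5 p. 3025] -/
theorem platt_parameters_proviso : (64 / 5 : ℝ) * (7 / 32) ≤ 20 := by norm_num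

end UpsamplingTruncation

open UpsamplingTruncation

/-! ## §5 Lemma 8.6 and Lemma 8.7 -/

/-- **Platt 2016, Lemma 8.6 (Math. Comp. 85, p. 3023) — in the form its printed proof yields.** As
printed: "Let `h, A > 0`, `t₀ = n₀/A` for some `n₀ ∈ ℤ_{>0}` and `S ∈ ℤ_{>0}`. Now define
`G(n) := (3/2 + t₀ + (S+n)/A)^{9/16} exp(-(S+n)²/(2A²h²))/(π(S+n))`. Then
`Σ_{n ≥ At₀+S} (3/2 + n/A)^{9/16} exp(-(n/A - t₀)²/(2h²)) sinc(πn - πAt₀) ≤ G(0)/(1 - G(1)/G(0))`."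
Here: `t₀ ≥ 0` is an arbitrary REAL number (for the printed `t₀ = n₀/A` every term vanishes), the
sum of the absolute values `|sinc|` over the integers `n ≥ At₀ + S` is bounded (summability included),
and the proviso `A h ≤ S` under which "the ratio `G(n+1)/G(n)` is decreasing" holds is explicit (see
the module docstring, items 1, 2, 5; Platt's `A = 64/5`, `h = 7/32`, `S = 20` satisfy it).
[cite: Platt2016GRH, Lemma 8.6 p. 3023] -/
theorem platt2016_lemma86 {h A t₀ : ℝ} (hh : 0 < h) (hA : 0 < A) (ht₀ : 0 ≤ t₀) {S : ℕ}
    (hS : 0 < S) (hSAh : A * h ≤ S) :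
    Summable (fun n : {n : ℤ // A * t₀ + S ≤ (n : ℝ)} =>
        (3 / 2 + (n : ℝ) / A) ^ (9 / 16 : ℝ) * Real.exp (-((n : ℝ) / A - t₀) ^ 2 / (2 * h ^ 2)) *
          |Real.sinc (π * n - π * A * t₀)|) ∧
      ∑' n : {n : ℤ // A * t₀ + S ≤ (n : ℝ)},
          (3 / 2 + (n : ℝ) / A) ^ (9 / 16 : ℝ) * Real.exp (-((n : ℝ) / A - t₀) ^ 2 / (2 * h ^ 2)) *
            |Real.sinc (π * n - π * A * t₀)| ≤
        ((3 / 2 + t₀ + S / A) ^ (9 / 16 : ℝ) * Real.exp (-(S : ℝ) ^ 2 / (2 * A ^ 2 * h ^ 2)) /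
            (π * S)) /
          (1 - ((3 / 2 + t₀ + (S + 1) / A) ^ (9 / 16 : ℝ) *
                Real.exp (-((S : ℝ) + 1) ^ 2 / (2 * A ^ 2 * h ^ 2)) / (π * (S + 1))) /
            ((3 / 2 + t₀ + S / A) ^ (9 / 16 : ℝ) * Real.exp (-(S : ℝ) ^ 2 / (2 * A ^ 2 * h ^ 2)) /
              (π * S))) := by
  have hπ : 0 < π := Real.pi_pos
  have hc : (0 : ℝ) ≤ 3 / 2 + t₀ := by positivity
  have hS' : (0 : ℝ) < S := by exact_mod_cast hS
  obtain ⟨hGs, hGle⟩ := majorant_summable_and_tsum_le hc hA hh hS' hSAh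
  set f : ℤ → ℝ := fun n => (3 / 2 + (n : ℝ) / A) ^ (9 / 16 : ℝ) *
    Real.exp (-((n : ℝ) / A - t₀) ^ 2 / (2 * h ^ 2)) * |Real.sinc (π * n - π * A * t₀)| with hf
  -- the printed termwise domination "`G(n)` is at least as large as the corresponding term"
  have hdom : ∀ n : ℤ, A * t₀ + S ≤ (n : ℝ) → f n ≤ 1 * ((3 / 2 + t₀ + ((n : ℝ) - A * t₀) / A) ^ (9 / 16 : ℝ) *
      Real.exp (-((n : ℝ) - A * t₀) ^ 2 / (2 * A ^ 2 * h ^ 2)) / (π * ((n : ℝ) - A * t₀))) := by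
    intro n hn
    have hu : 0 < (n : ℝ) - A * t₀ := by linarith
    have h1 : (3 / 2 + (n : ℝ) / A) = 3 / 2 + t₀ + ((n : ℝ) - A * t₀) / A := by field_simp; ring
    have h2 : Real.exp (-((n : ℝ) / A - t₀) ^ 2 / (2 * h ^ 2)) =
        Real.exp (-((n : ℝ) - A * t₀) ^ 2 / (2 * A ^ 2 * h ^ 2)) := by
      congr 1
      rw [show (n : ℝ) / A - t₀ = ((n : ℝ) - A * t₀) / A by field_simp, div_pow]
      field_simp
    have h3 : |Real.sinc (π * n - π * A * t₀)| ≤ 1 / (π * ((n : ℝ) - A * t₀)) := by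
      rw [show π * (n : ℝ) - π * A * t₀ = π * ((n : ℝ) - A * t₀) by ring]
      have hne : π * ((n : ℝ) - A * t₀) ≠ 0 := mul_ne_zero hπ.ne' hu.ne'
      refine (abs_sinc_le_one_div_abs hne).trans_eq ?_
      rw [abs_of_pos (mul_pos hπ hu)]
    have hb : 0 ≤ (3 / 2 + t₀ + ((n : ℝ) - A * t₀) / A) ^ (9 / 16 : ℝ) *
        Real.exp (-((n : ℝ) - A * t₀) ^ 2 / (2 * A ^ 2 * h ^ 2)) :=
      mul_nonneg (Real.rpow_nonneg (by positivity) _) (Real.exp_pos _).le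
    simp only [hf]
    rw [h1, h2, one_mul]
    calc _ ≤ (3 / 2 + t₀ + ((n : ℝ) - A * t₀) / A) ^ (9 / 16 : ℝ) *
          Real.exp (-((n : ℝ) - A * t₀) ^ 2 / (2 * A ^ 2 * h ^ 2)) * (1 / (π * ((n : ℝ) - A * t₀))) :=
          mul_le_mul_of_nonneg_left h3 hb
      _ = _ := by ring
  have hf0 : ∀ n : ℤ, A * t₀ + S ≤ (n : ℝ) → 0 ≤ f n := fun n hn => by
    have : 0 ≤ 3 / 2 + (n : ℝ) / A := by
      have : t₀ + S / A ≤ (n : ℝ) / A := by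
        rw [le_div_iff₀ hA, add_mul, div_mul_cancel₀ _ hA.ne']
        linarith
      have : (0:ℝ) ≤ S / A := by positivity
      linarith
    simp only [hf]
    exact mul_nonneg (mul_nonneg (Real.rpow_nonneg this _) (Real.exp_pos _).le) (abs_nonneg _)
  have hpart : ∀ T : Finset ℤ, (∀ n ∈ T, A * t₀ + S ≤ (n : ℝ)) → ∑ n ∈ T, f n ≤
      ((3 / 2 + t₀ + S / A) ^ (9 / 16 : ℝ) * Real.exp (-(S : ℝ) ^ 2 / (2 * A ^ 2 * h ^ 2)) /
            (π * S)) /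
          (1 - ((3 / 2 + t₀ + (S + 1) / A) ^ (9 / 16 : ℝ) *
                Real.exp (-((S : ℝ) + 1) ^ 2 / (2 * A ^ 2 * h ^ 2)) / (π * (S + 1))) /
            ((3 / 2 + t₀ + S / A) ^ (9 / 16 : ℝ) * Real.exp (-(S : ℝ) ^ 2 / (2 * A ^ 2 * h ^ 2)) /
              (π * S))) := by
    intro T hT
    have h := sum_right_tail_le hc hA hh hS' zero_le_one hSAh f T hT (fun n hn => hdom n (hT n hn))
    rw [one_mul] at h
    exact h.trans hGle
  exact summable_and_tsum_subtype_le (P := fun n : ℤ => A * t₀ + S ≤ (n : ℝ)) hf0 hpart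

/-- **Platt 2016, Lemma 8.7 (Math. Comp. 85, p. 3023) — in the form its printed proof yields.** As
printed: "Define `E := Σ_{|n| ≥ S} W(n/A) sinc(πA(n/A - t₀))`. Then for large enough `t₀` we have
`|E| ≤ √π ζ(9/8) exp(1/6) 2^{5/4} (q/2π)^{5/16} G(0)/(1 - G(1)/G(0))`", where
`W(t, χ) = Λ_χ(t) exp(-(t - t₀)²/(2h²))`, `Λ_χ(t) = ε (q/π)^{it/2} Γ((1/2 + a_χ + it)/2) e^{πt/4} L_χ(1/2+it)`
(pp. 3009, 3021) and `G` is the majorant of Lemma 8.6. Here: `χ` is primitive modulo `q > 1`,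
`|ε| = 1`, `h, A > 0`, `S ∈ ℤ_{>0}` with `A h ≤ S` (item 2 of the module docstring), `t₀ ≥ 0` is an
arbitrary real number and the tails are `|n - At₀| ≥ S` (items 1, 4), "for large enough `t₀`" is the
explicit condition `√(2π) e^{π/8+1/4} ≤ √π e^{1/6} (3 + 2t₀)^{1/4}` (item 3; `t₀ ≥ 12` suffices,
`platt2016_lemma87_of_twelve_le`); the series converges absolutely and the printed bound holds for the
norm of its sum. `ζ(9/8) = Booker2006Turing.bigZ (9/8)`. [cite: Platt2016GRH, Lemma 8.7 p. 3023] -/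
theorem platt2016_lemma87 {q : ℕ} [NeZero q] (hq : 1 < q) {χ : DirichletCharacter ℂ q}
    (hχ : χ.IsPrimitive) {ε : ℂ} (hε : ‖ε‖ = 1) {h A t₀ : ℝ} (hh : 0 < h) (hA : 0 < A)
    (ht₀ : 0 ≤ t₀)
    (hlarge : Real.sqrt (2 * π) * Real.exp (π / 8 + 1 / 4) ≤
      Real.sqrt π * Real.exp (1 / 6) * (3 + 2 * t₀) ^ (1 / 4 : ℝ))
    {S : ℕ} (hS : 0 < S) (hSAh : A * h ≤ S) :
    Summable (fun n : {n : ℤ // (S : ℝ) ≤ |(n : ℝ) - A * t₀|} =>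
        ε * ((q : ℂ) / π) ^ (I * ((n : ℝ) / A : ℝ) / 2) *
            Complex.Gamma ((1 / 2 + charParity χ + I * ((n : ℝ) / A : ℝ)) / 2) *
            Complex.exp (π * ((n : ℝ) / A : ℝ) / 4) * χ.LFunction (1 / 2 + I * ((n : ℝ) / A : ℝ)) *
          (Real.exp (-((n : ℝ) / A - t₀) ^ 2 / (2 * h ^ 2)) : ℂ) *
          (Real.sinc (π * A * ((n : ℝ) / A - t₀)) : ℂ)) ∧
      ‖∑' n : {n : ℤ // (S : ℝ) ≤ |(n : ℝ) - A * t₀|},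
          ε * ((q : ℂ) / π) ^ (I * ((n : ℝ) / A : ℝ) / 2) *
              Complex.Gamma ((1 / 2 + charParity χ + I * ((n : ℝ) / A : ℝ)) / 2) *
              Complex.exp (π * ((n : ℝ) / A : ℝ) / 4) * χ.LFunction (1 / 2 + I * ((n : ℝ) / A : ℝ)) *
            (Real.exp (-((n : ℝ) / A - t₀) ^ 2 / (2 * h ^ 2)) : ℂ) *
            (Real.sinc (π * A * ((n : ℝ) / A - t₀)) : ℂ)‖ ≤
        Real.sqrt π * Booker2006Turing.bigZ (9 / 8) * Real.exp (1 / 6) * (2 : ℝ) ^ (5 / 4 : ℝ) *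
            ((q : ℝ) / (2 * π)) ^ (5 / 16 : ℝ) *
          (((3 / 2 + t₀ + S / A) ^ (9 / 16 : ℝ) * Real.exp (-(S : ℝ) ^ 2 / (2 * A ^ 2 * h ^ 2)) /
              (π * S)) /
            (1 - ((3 / 2 + t₀ + (S + 1) / A) ^ (9 / 16 : ℝ) *
                  Real.exp (-((S : ℝ) + 1) ^ 2 / (2 * A ^ 2 * h ^ 2)) / (π * (S + 1))) /
              ((3 / 2 + t₀ + S / A) ^ (9 / 16 : ℝ) * Real.exp (-(S : ℝ) ^ 2 / (2 * A ^ 2 * h ^ 2)) /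
                (π * S)))) := by
  set K : ℝ := (Real.sqrt π * Real.exp (1 / 6)) * (2 : ℝ) ^ (1 / 4 : ℝ) * Booker2006Turing.bigZ (9 / 8) *
    ((q : ℝ) / (2 * π)) ^ (5 / 16 : ℝ) with hK
  have hZ : 0 ≤ Booker2006Turing.bigZ (9 / 8) := (Booker2006Turing.bigZ_pos (by norm_num)).le
  have hK0 : 0 ≤ K := by positivity
  have hΛ : ∀ t : ℝ, ‖ε * ((q : ℂ) / π) ^ (I * t / 2) *
      Complex.Gamma ((1 / 2 + charParity χ + I * t) / 2) * Complex.exp (π * t / 4) *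
      χ.LFunction (1 / 2 + I * t)‖ ≤ K * (3 / 2 + t₀ + |t - t₀|) ^ (9 / 16 : ℝ) :=
    fun t => norm_completedL_le hq hχ hε ht₀ le_rfl hlarge t
  have h := norm_tsum_tails_le (Λ := fun t : ℝ => ε * ((q : ℂ) / π) ^ (I * t / 2) *
      Complex.Gamma ((1 / 2 + charParity χ + I * t) / 2) * Complex.exp (π * t / 4) *
      χ.LFunction (1 / 2 + I * t)) hh hA ht₀ hK0 hΛ hS hSAh
  have h54 : (2 : ℝ) ^ (5 / 4 : ℝ) = 2 * (2 : ℝ) ^ (1 / 4 : ℝ) := by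
    rw [show (5 / 4 : ℝ) = 1 + 1 / 4 by norm_num, Real.rpow_add (by norm_num), Real.rpow_one]
  have hconst : 2 * K = Real.sqrt π * Booker2006Turing.bigZ (9 / 8) * Real.exp (1 / 6) *
      (2 : ℝ) ^ (5 / 4 : ℝ) * ((q : ℝ) / (2 * π)) ^ (5 / 16 : ℝ) := by
    rw [hK, h54]; ring
  rw [hconst] at h
  exact h

/-- **Lemma 8.7 for `t₀ ≥ 12`** ("for large enough `t₀`" discharged: `UpsamplingTruncation.
large_enough_of_twelve_le`). [cite: Platt2016GRH, Lemma 8.7 p. 3023] -/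
theorem platt2016_lemma87_of_twelve_le {q : ℕ} [NeZero q] (hq : 1 < q) {χ : DirichletCharacter ℂ q}
    (hχ : χ.IsPrimitive) {ε : ℂ} (hε : ‖ε‖ = 1) {h A t₀ : ℝ} (hh : 0 < h) (hA : 0 < A)
    (ht₀ : 12 ≤ t₀) {S : ℕ} (hS : 0 < S) (hSAh : A * h ≤ S) :
    Summable (fun n : {n : ℤ // (S : ℝ) ≤ |(n : ℝ) - A * t₀|} =>
        ε * ((q : ℂ) / π) ^ (I * ((n : ℝ) / A : ℝ) / 2) *
            Complex.Gamma ((1 / 2 + charParity χ + I * ((n : ℝ) / A : ℝ)) / 2) *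
            Complex.exp (π * ((n : ℝ) / A : ℝ) / 4) * χ.LFunction (1 / 2 + I * ((n : ℝ) / A : ℝ)) *
          (Real.exp (-((n : ℝ) / A - t₀) ^ 2 / (2 * h ^ 2)) : ℂ) *
          (Real.sinc (π * A * ((n : ℝ) / A - t₀)) : ℂ)) ∧
      ‖∑' n : {n : ℤ // (S : ℝ) ≤ |(n : ℝ) - A * t₀|},
          ε * ((q : ℂ) / π) ^ (I * ((n : ℝ) / A : ℝ) / 2) *
              Complex.Gamma ((1 / 2 + charParity χ + I * ((n : ℝ) / A : ℝ)) / 2) *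
              Complex.exp (π * ((n : ℝ) / A : ℝ) / 4) * χ.LFunction (1 / 2 + I * ((n : ℝ) / A : ℝ)) *
            (Real.exp (-((n : ℝ) / A - t₀) ^ 2 / (2 * h ^ 2)) : ℂ) *
            (Real.sinc (π * A * ((n : ℝ) / A - t₀)) : ℂ)‖ ≤
        Real.sqrt π * Booker2006Turing.bigZ (9 / 8) * Real.exp (1 / 6) * (2 : ℝ) ^ (5 / 4 : ℝ) *
            ((q : ℝ) / (2 * π)) ^ (5 / 16 : ℝ) *
          (((3 / 2 + t₀ + S / A) ^ (9 / 16 : ℝ) * Real.exp (-(S : ℝ) ^ 2 / (2 * A ^ 2 * h ^ 2)) /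
              (π * S)) /
            (1 - ((3 / 2 + t₀ + (S + 1) / A) ^ (9 / 16 : ℝ) *
                  Real.exp (-((S : ℝ) + 1) ^ 2 / (2 * A ^ 2 * h ^ 2)) / (π * (S + 1))) /
              ((3 / 2 + t₀ + S / A) ^ (9 / 16 : ℝ) * Real.exp (-(S : ℝ) ^ 2 / (2 * A ^ 2 * h ^ 2)) /
                (π * S)))) :=
  platt2016_lemma87 hq hχ hε hh hA (by linarith) (large_enough_of_twelve_le ht₀) hS hSAh

/-- **Lemma 8.7 for every `t₀ ≥ 0`** (no largeness condition), at the price of the constant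
`K₁ = max(√π e^{1/6}, √(2π) e^{π/8+1/4} / 3^{1/4})` in place of `√π e^{1/6}` (so that both branches
of Lemma 8.3 are covered for all `t`): the tails have norm at most
`K₁ ζ(9/8) 2^{5/4} (q/2π)^{5/16} G(0)/(1 - G(1)/G(0))`. [cite: Platt2016GRH, Lemma 8.7 p. 3023 (with
Lemma 8.3 p. 3021, both branches)] -/
theorem platt2016_lemma87_uniform {q : ℕ} [NeZero q] (hq : 1 < q) {χ : DirichletCharacter ℂ q}
    (hχ : χ.IsPrimitive) {ε : ℂ} (hε : ‖ε‖ = 1) {h A t₀ : ℝ} (hh : 0 < h) (hA : 0 < A)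
    (ht₀ : 0 ≤ t₀) {S : ℕ} (hS : 0 < S) (hSAh : A * h ≤ S) :
    Summable (fun n : {n : ℤ // (S : ℝ) ≤ |(n : ℝ) - A * t₀|} =>
        ε * ((q : ℂ) / π) ^ (I * ((n : ℝ) / A : ℝ) / 2) *
            Complex.Gamma ((1 / 2 + charParity χ + I * ((n : ℝ) / A : ℝ)) / 2) *
            Complex.exp (π * ((n : ℝ) / A : ℝ) / 4) * χ.LFunction (1 / 2 + I * ((n : ℝ) / A : ℝ)) *
          (Real.exp (-((n : ℝ) / A - t₀) ^ 2 / (2 * h ^ 2)) : ℂ) *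
          (Real.sinc (π * A * ((n : ℝ) / A - t₀)) : ℂ)) ∧
      ‖∑' n : {n : ℤ // (S : ℝ) ≤ |(n : ℝ) - A * t₀|},
          ε * ((q : ℂ) / π) ^ (I * ((n : ℝ) / A : ℝ) / 2) *
              Complex.Gamma ((1 / 2 + charParity χ + I * ((n : ℝ) / A : ℝ)) / 2) *
              Complex.exp (π * ((n : ℝ) / A : ℝ) / 4) * χ.LFunction (1 / 2 + I * ((n : ℝ) / A : ℝ)) *
            (Real.exp (-((n : ℝ) / A - t₀) ^ 2 / (2 * h ^ 2)) : ℂ) *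
            (Real.sinc (π * A * ((n : ℝ) / A - t₀)) : ℂ)‖ ≤
        max (Real.sqrt π * Real.exp (1 / 6))
            (Real.sqrt (2 * π) * Real.exp (π / 8 + 1 / 4) / (3 : ℝ) ^ (1 / 4 : ℝ)) *
            Booker2006Turing.bigZ (9 / 8) * (2 : ℝ) ^ (5 / 4 : ℝ) * ((q : ℝ) / (2 * π)) ^ (5 / 16 : ℝ) *
          (((3 / 2 + t₀ + S / A) ^ (9 / 16 : ℝ) * Real.exp (-(S : ℝ) ^ 2 / (2 * A ^ 2 * h ^ 2)) /
              (π * S)) /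
            (1 - ((3 / 2 + t₀ + (S + 1) / A) ^ (9 / 16 : ℝ) *
                  Real.exp (-((S : ℝ) + 1) ^ 2 / (2 * A ^ 2 * h ^ 2)) / (π * (S + 1))) /
              ((3 / 2 + t₀ + S / A) ^ (9 / 16 : ℝ) * Real.exp (-(S : ℝ) ^ 2 / (2 * A ^ 2 * h ^ 2)) /
                (π * S)))) := by
  set K₁ : ℝ := max (Real.sqrt π * Real.exp (1 / 6))
    (Real.sqrt (2 * π) * Real.exp (π / 8 + 1 / 4) / (3 : ℝ) ^ (1 / 4 : ℝ)) with hK₁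
  have h3 : 0 < (3 : ℝ) ^ (1 / 4 : ℝ) := Real.rpow_pos_of_pos (by norm_num) _
  have hK₁a : Real.sqrt π * Real.exp (1 / 6) ≤ K₁ := le_max_left _ _
  have hK₁0 : 0 ≤ K₁ := le_trans (by positivity) hK₁a
  have hlarge : Real.sqrt (2 * π) * Real.exp (π / 8 + 1 / 4) ≤ K₁ * (3 + 2 * t₀) ^ (1 / 4 : ℝ) := by
    have h1 : Real.sqrt (2 * π) * Real.exp (π / 8 + 1 / 4) =
        (Real.sqrt (2 * π) * Real.exp (π / 8 + 1 / 4) / (3 : ℝ) ^ (1 / 4 : ℝ)) * (3 : ℝ) ^ (1 / 4 : ℝ) := by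
      field_simp
    rw [h1]
    have h2 : (3 : ℝ) ^ (1 / 4 : ℝ) ≤ (3 + 2 * t₀) ^ (1 / 4 : ℝ) :=
      Real.rpow_le_rpow (by norm_num) (by linarith) (by norm_num)
    exact mul_le_mul (le_max_right _ _) h2 h3.le hK₁0
  set K : ℝ := K₁ * (2 : ℝ) ^ (1 / 4 : ℝ) * Booker2006Turing.bigZ (9 / 8) *
    ((q : ℝ) / (2 * π)) ^ (5 / 16 : ℝ) with hK
  have hZ : 0 ≤ Booker2006Turing.bigZ (9 / 8) := (Booker2006Turing.bigZ_pos (by norm_num)).le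
  have hK0 : 0 ≤ K := by positivity
  have hΛ : ∀ t : ℝ, ‖ε * ((q : ℂ) / π) ^ (I * t / 2) *
      Complex.Gamma ((1 / 2 + charParity χ + I * t) / 2) * Complex.exp (π * t / 4) *
      χ.LFunction (1 / 2 + I * t)‖ ≤ K * (3 / 2 + t₀ + |t - t₀|) ^ (9 / 16 : ℝ) :=
    fun t => norm_completedL_le hq hχ hε ht₀ hK₁a hlarge t
  have h := norm_tsum_tails_le (Λ := fun t : ℝ => ε * ((q : ℂ) / π) ^ (I * t / 2) *
      Complex.Gamma ((1 / 2 + charParity χ + I * t) / 2) * Complex.exp (π * t / 4) *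
      χ.LFunction (1 / 2 + I * t)) hh hA ht₀ hK0 hΛ hS hSAh
  have h54 : (2 : ℝ) ^ (5 / 4 : ℝ) = 2 * (2 : ℝ) ^ (1 / 4 : ℝ) := by
    rw [show (5 / 4 : ℝ) = 1 + 1 / 4 by norm_num, Real.rpow_add (by norm_num), Real.rpow_one]
  have hconst : 2 * K = K₁ * Booker2006Turing.bigZ (9 / 8) * (2 : ℝ) ^ (5 / 4 : ℝ) *
      ((q : ℝ) / (2 * π)) ^ (5 / 16 : ℝ) := by
    rw [hK, h54]; ring
  rw [hconst] at h
  exact h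

end Literature.NumberTheory.LFunctions

end
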